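import Literature.NumberTheory.Sieve.HeathBrownCubicApproxUWeights
import HarnessLib

/-!
# Heath-Brown's Lemma 3.7 from Lemma 7.1, IV: the Buchstab range (E3) through Lemma 7.1

Pure-proof file (no definitions) in the deduction of **Lemma 3.7 from the corrected Lemma 7.1** of
D. R. Heath-Brown, *Primes represented by `x³ + 2y³`*, Acta Math. 186 (2001), 1–84, §7 pp. 42–47
(decomposition of **parity.S18**, `Literature.NumberTheory.Sieve.setOf_prime_cube_add_two_mul_cube_infinite`).
The raw inequality `U_abs_sub_le` of `HeathBrownCubicApproxUCore` contains the Buchstab range (E3):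
replacing the sifting level `N(P_{n+1})` by `X^{m_{n+1}ξ}` in `S_K(𝒵_{P_1⋯P_{n+1}}, ·)` "introduces an
error `∑_{X^{m_{n+1}ξ} ≤ N(P) < N(P_{n+1})} S_K(𝒵_{P_1⋯P_{n+1}P}, N(P))`. We sum over the various prime
ideals `P_1, …, P_{n+1}`, using Lemma 7.1, along with (7.1) and (7.4)" (p. 44). This file carries
that out for a general family with Lemma 7.1 as hypothesis `h7` (`normIn` form):

* `buchstab_prime_props`, `buchstab_count_le` — a prime `Q` of the range is a NEW prime factor
  (`Q ∤ ∏P_i`), so the count is `S_K(𝒵_{Q∏P_i}, ·) ≤ S_K(𝒵_{Q∏P_i}, X^τ)` and `≤ #𝒵_{Q∏P_i}`; moreover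
  `N(Q) ≤ N(P_{n+1}) < N(Q)X^ξ` (a close pair) and `X^τ ≤ N(Q) < X^{1−τ}`.
* The primes `Q` of degree `≥ 2` or sharing a norm with some `P_i` are set aside as the raw term
  (E3ii) `∑ #𝒵_{Q∏P_i}` (nothing for `𝒜^(K)` by Lemma 3.1; (7.7) for `ℬ^(K)`).
* **Regime 1**, `N(Q∏P_i) < X^{2−2τ}` (always the case for `n ≥ 3`): `tuple_normset_props`,
  `buchstab_mul_injOn` (`((𝐦,P),Q) ↦ Q∏P_i` is injective: `Q` is the factor of least norm),
  **`E3_regime1_le`** — Lemma 7.1 at level `X^τ` on `[X^{1+2τ}, X^{2−2τ})`, patterns `(n+2)`-subsets of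
  `P0` in the close class: `≤ C₇ (M/(τ log X)) (∑_{P0} w) B_ξ e_n + 3 log X · C₇ Err`,
  `B_ξ = 2(ξ log X + C₁)/(τ log X)`.
* **Regime 2**, `N(Q∏P_i) ≥ X^{2−2τ}` (possible only for `n ≤ 2`, where the printed argument — "the
  treatment of `U₁^(1)` and `U₁^(2)` … follows the lines given above", p. 46 — would apply Lemma 7.1
  beyond its range `N ≪ X^{2−τ}`): here `N(Q) > X^{1/2−τ}`, every prime factor of a counted member
  exceeds `X^{1/2−2τ}`, so the member has at most `6` prime factors (`card_primeFactorsFinset_le_six`),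
  and counting through the pair `(Q·P_{n+1}, i)` has multiplicity `≤ C(6,n) ≤ 20`
  (**`E3_regime2_count_le`**); the ideals `Q·P_{n+1}` (square-free norms `qp`, `q < p < qX^ξ`, in
  `[X^{2τ}, X^{2−2τ})`) are then sieved by Lemma 7.1 (**`E3_regime2_Dsum_le`**). This is the device of
  p. 47 ("all the errors in the subsequent manoeuvres can still be estimated via Lemma 7.1, in view of
  the bound `#{P_2 : P_1P_2 ∈ 𝒜_{Q_1⋯Q_{n+1}}} ≤ S_K(𝒜_{Q_1⋯Q_{n+1}}, X^τ)`") transposed to `U₁^(n)`.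
* **`E3_le`**: (E3) `≤` (E3ii) `+ C₇ (M/(τ log X)) (∑_{P0} w) B_ξ (e_n + 20) + 63 log X · C₇ Err`.

## References

* D. R. Heath-Brown, *Primes represented by `x³ + 2y³`*, Acta Math. 186 (2001), 1–84: §7 pp. 44–47.
  [cite: HeathBrownActa2001, §7 pp. 44–47]
* G. Harman, *Prime-Detecting Sieves*, LMS Monographs 33, Princeton (2007), §13.2. [cite: Harman2007, §13.2]

## Mathlib / tree search

Mathlib: `Finset.prod_primes_dvd` (with `Subsingleton (Ideal R)ˣ`), `Nat.choose_le_choose`,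
`Nat.choose_le_middle`, `Finset.card_le_card_of_injOn`, `Finset.card_eq_sum_card_fiberwise`,
`Finset.sum_boole`, `Nat.squarefree_mul`, `Finset.squarefree_prod_of_pairwise_isCoprime`, `Finset.prod_pair`.
Tree: `HeathBrownCubicApproxUWeights` (`sum_class_close_le`, `mem_P0_iff`), `HeathBrownCubicApproxUCore`
(`U_index_props`, `toPair_injOn`, `image_castSucc_props`), `HeathBrownCubicApproxS4` (`sum_le_of_image_normIn`),
`HeathBrownCubicHatCore` (`tuple_eq_of_prod_eq`, `mul_dvd_of_not_dvd`, `famSifted_antitone`),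
`HeathBrownCubicUpperBoundTools` (`eq_of_prod_eq_prod`), `HeathBrownCubicSieveSetup` (`primeFactorsFinset`).
-/

noncomputable section

open Polynomial NumberField Finset Filter Topology Asymptotics
open scoped nonZeroDivisors

namespace Literature.NumberTheory.Sieve.CubicSieve

open LFunctions.CubeRootTwoField CubicPrimes
open Literature.NumberTheory.LFunctions (idealNormCount)

section E3

variable {ι : Type*} (E : Finset ι) (I : ι → Ideal (𝓞 K)) {X τ C₇ C₁ M Err : ℝ} {n : ℕ}

/-- **A prime of the Buchstab range is a new prime factor.** For an admissible tuple `(𝐦, (P_i))`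
and a prime `Q ≺ P_{n+1}` with `N(Q) ≥ X^{m_{n+1}ξ}`: `Q ≠ P_i` for all `i`, `Q ∤ ∏P_i`, so every
member counted in the Buchstab range is divisible by `Q·∏P_i`; `N(Q) ≤ N(P_{n+1}) < N(Q)·X^ξ` and
`X^τ ≤ N(Q) < X^{1−τ}`. [cite: HeathBrownActa2001, §7 p. 44] -/
theorem buchstab_prime_props (hX : 1 < X) (hτ : 0 < τ) (hτ1 : τ ≤ 1)
    {m : Fin (n + 1) → ℕ} (hm : m ∈ mIndexU τ n) {P : Fin (n + 1) → Ideal (𝓞 K)}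
    (hP : P ∈ Fintype.piFinset fun i => Jprimes X τ (m i)) {Q : Ideal (𝓞 K)}
    (hQ : Q.IsPrime) (hQ0 : Q ≠ ⊥) (hzQ : X ^ ((m (Fin.last n) : ℝ) * hbXi τ) ≤ (Ideal.absNorm Q : ℝ))
    (hlt : PrimeLT Q (P (Fin.last n))) :
    (∀ j, Q ≠ P j) ∧ ¬ Q ∣ ∏ j, P j ∧
      (Ideal.absNorm Q : ℝ) ≤ Ideal.absNorm (P (Fin.last n)) ∧
      (Ideal.absNorm (P (Fin.last n)) : ℝ) < Ideal.absNorm Q * X ^ hbXi τ ∧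
      X ^ τ ≤ (Ideal.absNorm Q : ℝ) ∧ (Ideal.absNorm Q : ℝ) < X ^ (1 - τ) := by
  have hX0 : 0 < X := by linarith
  obtain ⟨-, hJ, hsmall, hSA, -, -, -, -, -, hτz⟩ := U_index_props hX hτ hτ1 hm hP
  have hNle : Ideal.absNorm Q ≤ Ideal.absNorm (P (Fin.last n)) := hlt.absNorm_le
  have hne : ∀ j, Q ≠ P j := by
    intro j h
    subst h
    rcases eq_or_ne j (Fin.last n) with rfl | hj
    · exact primeLT_irrefl _ hlt
    · have hjl : j < Fin.last n := lt_of_le_of_ne (Fin.le_last j) hj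
      have h1 : Ideal.absNorm (P (Fin.last n)) < Ideal.absNorm (P j) := hSA hjl
      exact absurd hNle (not_le.mpr h1)
  have hndvd : ¬ Q ∣ ∏ j, P j := by
    intro hd
    have hpr : Prime Q := Ideal.prime_of_isPrime hQ0 hQ
    obtain ⟨j, -, hj⟩ := hpr.exists_mem_finset_dvd hd
    exact hne j ((((hJ j).1.isMaximal (hJ j).2.1).eq_of_le hQ.ne_top (Ideal.le_of_dvd hj)).symm)
  refine ⟨hne, hndvd, by exact_mod_cast hNle, ?_, hτz.trans hzQ, ?_⟩
  · calc (Ideal.absNorm (P (Fin.last n)) : ℝ) < X ^ (((m (Fin.last n) : ℝ) + 1) * hbXi τ) := (hJ _).2.2.2.2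
      _ = X ^ ((m (Fin.last n) : ℝ) * hbXi τ) * X ^ hbXi τ := by rw [← Real.rpow_add hX0]; ring_nf
      _ ≤ Ideal.absNorm Q * X ^ hbXi τ := mul_le_mul_of_nonneg_right hzQ (Real.rpow_nonneg hX0.le _)
  · have h1 : (Ideal.absNorm (P (Fin.last n)) : ℝ) < X ^ (1 - τ) := (mem_smallPrimes_iff.mp (hsmall _)).2.2.2
    have h2 : (Ideal.absNorm Q : ℝ) ≤ Ideal.absNorm (P (Fin.last n)) := by exact_mod_cast hNle
    linarith

open scoped Classical in
/-- **The Buchstab count at a new prime is a sifting function / a family count of `Q·∏P_i`.**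
[cite: HeathBrownActa2001, §7 p. 44] -/
theorem buchstab_count_le (hX : 1 < X) (hτ : 0 < τ) (hτ1 : τ ≤ 1)
    {m : Fin (n + 1) → ℕ} (hm : m ∈ mIndexU τ n) {P : Fin (n + 1) → Ideal (𝓞 K)}
    (hP : P ∈ Fintype.piFinset fun i => Jprimes X τ (m i)) {Q : Ideal (𝓞 K)}
    (hQ : Q.IsPrime) (hQ0 : Q ≠ ⊥) (hzQ : X ^ ((m (Fin.last n) : ℝ) * hbXi τ) ≤ (Ideal.absNorm Q : ℝ))
    (hlt : PrimeLT Q (P (Fin.last n))) :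
    #{i ∈ E | (∏ j, P j) ∣ I i ∧ Q ∣ I i ∧ IsRough (X ^ ((m (Fin.last n) : ℝ) * hbXi τ)) (I i)} =
      famSifted E I (Q * ∏ j, P j) (X ^ ((m (Fin.last n) : ℝ) * hbXi τ)) ∧
    (famSifted E I (Q * ∏ j, P j) (X ^ ((m (Fin.last n) : ℝ) * hbXi τ)) ≤
      famSifted E I (Q * ∏ j, P j) (X ^ τ)) ∧
    #{i ∈ E | (∏ j, P j) ∣ I i ∧ Q ∣ I i ∧ IsRough (X ^ ((m (Fin.last n) : ℝ) * hbXi τ)) (I i)} ≤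
      famCount E I (Q * ∏ j, P j) := by
  classical
  obtain ⟨-, hndvd, -⟩ := buchstab_prime_props hX hτ hτ1 hm hP hQ hQ0 hzQ hlt
  obtain ⟨-, -, -, -, -, -, -, -, -, hτz⟩ := U_index_props hX hτ hτ1 hm hP
  have heq : (E.filter fun i => (∏ j, P j) ∣ I i ∧ Q ∣ I i ∧ IsRough (X ^ ((m (Fin.last n) : ℝ) * hbXi τ)) (I i)) =
      E.filter fun i => Q * (∏ j, P j) ∣ I i ∧ IsRough (X ^ ((m (Fin.last n) : ℝ) * hbXi τ)) (I i) := by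
    refine filter_congr fun i _ => ⟨fun h => ⟨mul_dvd_of_not_dvd hQ hQ0 hndvd h.1 h.2.1, h.2.2⟩,
      fun h => ⟨(dvd_mul_left _ Q).trans h.1, (dvd_mul_right Q _).trans h.1, h.2⟩⟩
  refine ⟨by rw [heq, famSifted], famSifted_antitone E I hτz, ?_⟩
  rw [heq, famCount]
  exact card_le_card (monotone_filter_right _ fun i _ h => h.1)

end E3

section E3r1

variable {ι : Type*} (E : Finset ι) (I : ι → Ideal (𝓞 K)) {X τ C₇ C₁ M Err : ℝ} {n : ℕ}

/-- The norm set `{N(P_1),…,N(P_{n+1})}` of an admissible tuple: an `(n+1)`-subset of `P0` with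
product `N(∏P_i)`. [cite: HeathBrownActa2001, §7 (7.4)] -/
theorem tuple_normset_props (hX : 1 < X) (hτ : 0 < τ) (hτ1 : τ ≤ 1)
    {m : Fin (n + 1) → ℕ} (hm : m ∈ mIndexU τ n) {P : Fin (n + 1) → Ideal (𝓞 K)}
    (hP : P ∈ Fintype.piFinset fun i => Jprimes X τ (m i)) :
    (univ : Finset (Fin (n + 1))).image (fun j => Ideal.absNorm (P j)) ⊆
        (range (⌊X ^ (1 - τ)⌋₊ + 1)).filter
          (fun p : ℕ => p.Prime ∧ X ^ τ ≤ (p : ℝ) ∧ (p : ℝ) < X ^ (1 - τ)) ∧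
      #((univ : Finset (Fin (n + 1))).image (fun j => Ideal.absNorm (P j))) = n + 1 ∧
      (∏ p ∈ (univ : Finset (Fin (n + 1))).image (fun j => Ideal.absNorm (P j)), p) =
        Ideal.absNorm (∏ j, P j) ∧
      Squarefree (Ideal.absNorm (∏ j, P j)) := by
  classical
  obtain ⟨-, hJ, hsmall, hSA, -⟩ := U_index_props hX hτ hτ1 hm hP
  have hinj : Function.Injective fun j => Ideal.absNorm (P j) := hSA.injective
  have hsub : (univ : Finset (Fin (n + 1))).image (fun j => Ideal.absNorm (P j)) ⊆
      (range (⌊X ^ (1 - τ)⌋₊ + 1)).filter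
        (fun p : ℕ => p.Prime ∧ X ^ τ ≤ (p : ℝ) ∧ (p : ℝ) < X ^ (1 - τ)) := by
    intro p hp
    obtain ⟨j, -, rfl⟩ := mem_image.mp hp
    have h := mem_smallPrimes_iff.mp (hsmall j)
    exact mem_P0_iff.mpr ⟨(hJ j).2.2.1, h.2.2.1, h.2.2.2⟩
  have hprod : (∏ p ∈ (univ : Finset (Fin (n + 1))).image (fun j => Ideal.absNorm (P j)), p) =
      Ideal.absNorm (∏ j, P j) := by
    rw [prod_image fun j _ j' _ h => hinj h, map_prod]
  refine ⟨hsub, by rw [card_image_of_injective _ hinj, card_univ, Fintype.card_fin], hprod, ?_⟩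
  rw [← hprod]
  exact Finset.squarefree_prod_of_pairwise_isCoprime
    (fun p hp q hq hpq => by
      obtain ⟨j, -, rfl⟩ := mem_image.mp hp
      obtain ⟨j', -, rfl⟩ := mem_image.mp hq
      exact Nat.coprime_iff_isRelPrime.mp ((Nat.coprime_primes (hJ j).2.2.1 (hJ j').2.2.1).mpr hpq))
    fun p hp => by
      obtain ⟨j, -, rfl⟩ := mem_image.mp hp
      exact (hJ j).2.2.1.prime.squarefree

open scoped Classical in
/-- **Injectivity of `(𝐦, P, Q) ↦ Q·∏P_i` on the Buchstab pairs with a new first-degree prime `Q`**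
(whose norm differs from all `N(P_i)`): `Q` is recovered as the prime factor of least norm, then
`∏P_i` by cancellation and the tuple by `tuple_eq_of_prod_eq`. [cite: HeathBrownActa2001, §7 p. 44] -/
theorem buchstab_mul_injOn (hX : 1 < X) (hτ : 0 < τ) (hτ1 : τ ≤ 1) :
    Set.InjOn (fun x : (Σ _ : (Σ _ : Fin (n + 1) → ℕ, Fin (n + 1) → Ideal (𝓞 K)), Ideal (𝓞 K)) =>
        x.2 * ∏ j, x.1.2 j)
      (((mIndexU τ n).sigma (fun m => Fintype.piFinset fun i => Jprimes X τ (m i))).sigma (fun b =>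
        ((idealsLE (Ideal.absNorm (b.2 (Fin.last n)))).filter
          (fun Q => Q.IsPrime ∧ Q ≠ ⊥ ∧ X ^ ((b.1 (Fin.last n) : ℝ) * hbXi τ) ≤ (Ideal.absNorm Q : ℝ) ∧
            PrimeLT Q (b.2 (Fin.last n)))).filter
          (fun Q => (Ideal.absNorm Q).Prime ∧ ∀ j, Ideal.absNorm Q ≠ Ideal.absNorm (b.2 j))) : Set _) := by
  classical
  -- unpack a member
  have hunpack : ∀ x ∈ ((mIndexU τ n).sigma (fun m => Fintype.piFinset fun i => Jprimes X τ (m i))).sigma (fun b =>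
        ((idealsLE (Ideal.absNorm (b.2 (Fin.last n)))).filter
          (fun Q => Q.IsPrime ∧ Q ≠ ⊥ ∧ X ^ ((b.1 (Fin.last n) : ℝ) * hbXi τ) ≤ (Ideal.absNorm Q : ℝ) ∧
            PrimeLT Q (b.2 (Fin.last n)))).filter
          (fun Q => (Ideal.absNorm Q).Prime ∧ ∀ j, Ideal.absNorm Q ≠ Ideal.absNorm (b.2 j))),
      x.1.1 ∈ mIndexU τ n ∧ (x.1.2 ∈ Fintype.piFinset fun i => Jprimes X τ (x.1.1 i)) ∧
      x.2.IsPrime ∧ x.2 ≠ ⊥ ∧ (∀ j, (x.1.2 j).IsPrime ∧ x.1.2 j ≠ ⊥) ∧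
      (∀ j, Ideal.absNorm x.2 < Ideal.absNorm (x.1.2 j)) ∧ (∀ j, x.2 ≠ x.1.2 j) ∧
      StrictAnti x.1.1 := by
    rintro ⟨⟨m, P⟩, Q⟩ hx
    simp only [mem_sigma, mem_filter] at hx
    obtain ⟨⟨hm, hP⟩, ⟨-, hQp, hQ0, hzQ, hlt⟩, hpr, hneN⟩ := hx
    obtain ⟨hadm, hJ, -, hSA, -⟩ := U_index_props hX hτ hτ1 hm hP
    obtain ⟨hne, -, hNle, -⟩ := buchstab_prime_props hX hτ hτ1 hm hP hQp hQ0 hzQ hlt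
    refine ⟨hm, hP, hQp, hQ0, fun j => ⟨(hJ j).1, (hJ j).2.1⟩, fun j => ?_, hne, hadm.1.1⟩
    have h1 : Ideal.absNorm Q ≤ Ideal.absNorm (P (Fin.last n)) := by exact_mod_cast hNle
    have h2 : Ideal.absNorm (P (Fin.last n)) ≤ Ideal.absNorm (P j) := hSA.antitone (Fin.le_last j)
    exact lt_of_le_of_ne (h1.trans h2) (hneN j)
  rintro x hx x' hx' h
  obtain ⟨hm, hP, hQp, hQ0, hPp, hNlt, hne, hanti⟩ := hunpack x hx
  obtain ⟨hm', hP', hQp', hQ0', hPp', hNlt', hne', hanti'⟩ := hunpack x' hx'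
  simp only at h
  -- the prime factor sets agree
  set F : Finset (Ideal (𝓞 K)) := insert x.2 ((univ : Finset (Fin (n + 1))).image x.1.2) with hF
  set F' : Finset (Ideal (𝓞 K)) := insert x'.2 ((univ : Finset (Fin (n + 1))).image x'.1.2) with hF'
  have hinjP : Function.Injective x.1.2 := fun i j hij =>
    (strictAnti_absNorm_of_mem_piFinset hX hτ hanti hP).injective (by simp only [hij])
  have hinjP' : Function.Injective x'.1.2 := fun i j hij =>
    (strictAnti_absNorm_of_mem_piFinset hX hτ hanti' hP').injective (by simp only [hij])
  have hnot : x.2 ∉ (univ : Finset (Fin (n + 1))).image x.1.2 := fun hmem => by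
    obtain ⟨j, -, hj⟩ := mem_image.mp hmem; exact hne j hj.symm
  have hnot' : x'.2 ∉ (univ : Finset (Fin (n + 1))).image x'.1.2 := fun hmem => by
    obtain ⟨j, -, hj⟩ := mem_image.mp hmem; exact hne' j hj.symm
  have hprodF : ∏ Q ∈ F, Q = x.2 * ∏ j, x.1.2 j := by
    rw [hF, prod_insert hnot, prod_image fun i _ j _ hij => hinjP hij]
  have hprodF' : ∏ Q ∈ F', Q = x'.2 * ∏ j, x'.1.2 j := by
    rw [hF', prod_insert hnot', prod_image fun i _ j _ hij => hinjP' hij]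
  have hFp : ∀ Q ∈ F, Q.IsPrime ∧ Q ≠ ⊥ := by
    intro Q hQ
    rcases mem_insert.mp hQ with rfl | hQ
    · exact ⟨hQp, hQ0⟩
    · obtain ⟨j, -, rfl⟩ := mem_image.mp hQ; exact hPp j
  have hFp' : ∀ Q ∈ F', Q.IsPrime ∧ Q ≠ ⊥ := by
    intro Q hQ
    rcases mem_insert.mp hQ with rfl | hQ
    · exact ⟨hQp', hQ0'⟩
    · obtain ⟨j, -, rfl⟩ := mem_image.mp hQ; exact hPp' j
  have hFF : F = F' := eq_of_prod_eq_prod hFp hFp' (by rw [hprodF, hprodF', h])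
  -- `Q = Q'`
  have hQQ : x.2 = x'.2 := by
    have h1 : x.2 ∈ F' := by rw [← hFF]; exact mem_insert_self _ _
    have h2 : x'.2 ∈ F := by rw [hFF]; exact mem_insert_self _ _
    rcases mem_insert.mp h1 with h1 | h1
    · exact h1
    · obtain ⟨j, -, hj⟩ := mem_image.mp h1
      rcases mem_insert.mp h2 with h2 | h2
      · exact h2.symm
      · obtain ⟨j', -, hj'⟩ := mem_image.mp h2
        have e1 := hNlt j'   -- N Q < N (P j') = N Q'
        have e2 := hNlt' j   -- N Q' < N (P' j) = N Q
        rw [hj'] at e1; rw [hj] at e2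
        omega
  -- cancel and conclude
  have hprod : ∏ j, x.1.2 j = ∏ j, x'.1.2 j := by
    have h' : x.2 * ∏ j, x.1.2 j = x.2 * ∏ j, x'.1.2 j := by rw [h, hQQ]
    exact mul_left_cancel₀ (show x.2 ≠ 0 from hQ0) h'
  obtain ⟨hPP, hmm⟩ := tuple_eq_of_prod_eq hX hτ hanti hanti' hP hP' hprod
  obtain ⟨⟨m, P⟩, Q⟩ := x
  obtain ⟨⟨m', P'⟩, Q'⟩ := x'
  simp only at hPP hmm hQQ
  subst hPP; subst hmm; subst hQQ; rfl

end E3r1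

section E3r1bound

variable {ι : Type*} (E : Finset ι) (I : ι → Ideal (𝓞 K)) {X τ C₇ C₁ M Err : ℝ} {n : ℕ}

open scoped Classical in
/-- **(E3), regime `N(Q·∏P_i) < X^{2−2τ}`, through Lemma 7.1.** The Buchstab pairs `((𝐦,P), Q)` with
`Q` a new first-degree prime and `N(Q)N(∏P_i) < X^{2−2τ}` give distinct ideals `Q·∏P_i` of
square-free norm whose patterns are `(n+2)`-subsets of `P0` with the two least members within a
factor `X^ξ`; hence
`∑ S_K(𝒵_{Q∏P_i}, X^τ) ≤ C₇ (M/(τ log X)) · (∑_{P0} w) · 2(ξ log X + C₁)/(τ log X) · e_n(P0) + 3 log X · C₇ Err`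
— the bound "`≪ (η²X²/(τ log X)) ξτ^{-1} (log τ^{-1})^{n+1}/(n+1)!`"-shape of p. 44 for the Buchstab
error. [cite: HeathBrownActa2001, §7 p. 44] -/
theorem E3_regime1_le (hC₁ : 0 ≤ C₁)
    (hwin : ∀ (lo hi : ℝ) (T : Finset ℕ), 2 ≤ lo → lo ≤ hi →
      (∀ p ∈ T, p.Prime ∧ lo < (p : ℝ) ∧ (p : ℝ) ≤ hi) →
      ∑ p ∈ T, (idealNormCount K p : ℝ) * (p : ℝ)⁻¹ ≤
        Real.log (Real.log hi / Real.log lo) + C₁ / Real.log lo)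
    (hX : (2 : ℝ) ^ 15 ≤ X) (hτ : 0 < τ) (hτ1 : τ ≤ 1 / 8) (hXτ : 4 ≤ X ^ τ)
    (hC₇ : 0 ≤ C₇) (hM : 0 ≤ M) (hErr : 0 ≤ Err)
    (h7 : ∀ (N z : ℝ) (𝒬 : Finset ℕ), X ^ τ ≤ z → 0 < N → N ≤ X ^ (2 - 2 * τ) →
        (∀ q ∈ 𝒬, Squarefree q ∧ N < q ∧ (q : ℝ) ≤ 2 * N) →
        ∑ Q ∈ normIn 𝒬, (famSifted E I Q z : ℝ) ≤
          C₇ * (M / Real.log (min z (X ^ (2 - τ) / N)) *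
            ∑ Q ∈ normIn 𝒬, ((Ideal.absNorm Q : ℕ) : ℝ)⁻¹ + Err)) :
    ∑ x ∈ ((mIndexU τ n).sigma (fun m => Fintype.piFinset fun i => Jprimes X τ (m i))).sigma (fun b =>
        ((idealsLE (Ideal.absNorm (b.2 (Fin.last n)))).filter
          (fun Q => Q.IsPrime ∧ Q ≠ ⊥ ∧ X ^ ((b.1 (Fin.last n) : ℝ) * hbXi τ) ≤ (Ideal.absNorm Q : ℝ) ∧
            PrimeLT Q (b.2 (Fin.last n)))).filter
          (fun Q => (Ideal.absNorm Q).Prime ∧ (∀ j, Ideal.absNorm Q ≠ Ideal.absNorm (b.2 j)) ∧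
            (Ideal.absNorm Q : ℝ) * Ideal.absNorm (∏ j, b.2 j) < X ^ (2 - 2 * τ))),
        (famSifted E I (x.2 * ∏ j, x.1.2 j) (X ^ τ) : ℝ) ≤
      C₇ * (M / (τ * Real.log X)) *
        ((∑ p ∈ (range (⌊X ^ (1 - τ)⌋₊ + 1)).filter
            (fun p : ℕ => p.Prime ∧ X ^ τ ≤ (p : ℝ) ∧ (p : ℝ) < X ^ (1 - τ)), (idealNormCount K p : ℝ) * (p : ℝ)⁻¹) *
          (2 * (hbXi τ * Real.log X + C₁) / (τ * Real.log X)) *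
          ∑ σ' ∈ ((range (⌊X ^ (1 - τ)⌋₊ + 1)).filter
              (fun p : ℕ => p.Prime ∧ X ^ τ ≤ (p : ℝ) ∧ (p : ℝ) < X ^ (1 - τ))).powersetCard n,
            ∏ p ∈ σ', (idealNormCount K p : ℝ) * (p : ℝ)⁻¹) +
      3 * Real.log X * (C₇ * Err) := by
  classical
  have hX1 : 1 < X := lt_of_lt_of_le (by norm_num) hX
  have hX0 : 0 < X := by linarith
  have hτ1' : τ ≤ 1 := by linarith
  set L := Real.log X with hL
  have hL10 : 10 ≤ L := ten_le_log hX
  have hL0 : 0 < L := by linarith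
  set P0 := (range (⌊X ^ (1 - τ)⌋₊ + 1)).filter
    (fun p : ℕ => p.Prime ∧ X ^ τ ≤ (p : ℝ) ∧ (p : ℝ) < X ^ (1 - τ)) with hP0
  set A : Finset (Σ _ : Fin (n + 1) → ℕ, Fin (n + 1) → Ideal (𝓞 K)) :=
    (mIndexU τ n).sigma (fun m => Fintype.piFinset fun i => Jprimes X τ (m i)) with hA
  set PP := A.sigma (fun b =>
        ((idealsLE (Ideal.absNorm (b.2 (Fin.last n)))).filter
          (fun Q => Q.IsPrime ∧ Q ≠ ⊥ ∧ X ^ ((b.1 (Fin.last n) : ℝ) * hbXi τ) ≤ (Ideal.absNorm Q : ℝ) ∧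
            PrimeLT Q (b.2 (Fin.last n)))).filter
          (fun Q => (Ideal.absNorm Q).Prime ∧ (∀ j, Ideal.absNorm Q ≠ Ideal.absNorm (b.2 j)) ∧
            (Ideal.absNorm Q : ℝ) * Ideal.absNorm (∏ j, b.2 j) < X ^ (2 - 2 * τ))) with hPP
  set ψ : (Σ _ : (Σ _ : Fin (n + 1) → ℕ, Fin (n + 1) → Ideal (𝓞 K)), Ideal (𝓞 K)) → Ideal (𝓞 K) :=
    fun x => x.2 * ∏ j, x.1.2 j with hψ
  set ρ : (Σ _ : (Σ _ : Fin (n + 1) → ℕ, Fin (n + 1) → Ideal (𝓞 K)), Ideal (𝓞 K)) → Finset ℕ :=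
    fun x => insert (Ideal.absNorm x.2) ((univ : Finset (Fin (n + 1))).image fun j => Ideal.absNorm (x.1.2 j))
    with hρ
  -- unpack a member
  have hmemb : ∀ x ∈ PP, x.1.1 ∈ mIndexU τ n ∧ (x.1.2 ∈ Fintype.piFinset fun i => Jprimes X τ (x.1.1 i)) ∧
      x.2.IsPrime ∧ x.2 ≠ ⊥ ∧ (Ideal.absNorm x.2).Prime ∧
      (∀ j, Ideal.absNorm x.2 ≠ Ideal.absNorm (x.1.2 j)) ∧
      (Ideal.absNorm x.2 : ℝ) * Ideal.absNorm (∏ j, x.1.2 j) < X ^ (2 - 2 * τ) ∧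
      Ideal.absNorm x.2 < Ideal.absNorm (x.1.2 (Fin.last n)) ∧
      (Ideal.absNorm (x.1.2 (Fin.last n)) : ℝ) < Ideal.absNorm x.2 * X ^ hbXi τ ∧
      X ^ τ ≤ (Ideal.absNorm x.2 : ℝ) ∧ (Ideal.absNorm x.2 : ℝ) < X ^ (1 - τ) := by
    rintro ⟨⟨m, P⟩, Q⟩ hx
    simp only [hPP, hA, mem_sigma, mem_filter] at hx
    obtain ⟨⟨hm, hP⟩, ⟨-, hQp, hQ0, hzQ, hlt⟩, hpr, hneN, hreg⟩ := hx
    obtain ⟨-, -, hNle, hclose, hτQ, hQ1⟩ := buchstab_prime_props hX1 hτ hτ1' hm hP hQp hQ0 hzQ hlt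
    refine ⟨hm, hP, hQp, hQ0, hpr, hneN, hreg, ?_, hclose, hτQ, hQ1⟩
    exact lt_of_le_of_ne (by exact_mod_cast hNle) (hneN _)
  -- injectivity of `ψ` on `PP`
  have hsub : PP ⊆ A.sigma (fun b =>
        ((idealsLE (Ideal.absNorm (b.2 (Fin.last n)))).filter
          (fun Q => Q.IsPrime ∧ Q ≠ ⊥ ∧ X ^ ((b.1 (Fin.last n) : ℝ) * hbXi τ) ≤ (Ideal.absNorm Q : ℝ) ∧
            PrimeLT Q (b.2 (Fin.last n)))).filter
          (fun Q => (Ideal.absNorm Q).Prime ∧ ∀ j, Ideal.absNorm Q ≠ Ideal.absNorm (b.2 j))) := by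
    intro x hx
    simp only [hPP, mem_sigma, mem_filter] at hx ⊢
    exact ⟨hx.1, hx.2.1, hx.2.2.1, hx.2.2.2.1⟩
  have hinj : Set.InjOn ψ PP := (buchstab_mul_injOn hX1 hτ hτ1').mono (Finset.coe_subset.mpr hsub)
  -- norms and patterns of the ideals `ψ x`
  have hnorm : ∀ x ∈ PP, (∏ p ∈ ρ x, p) = Ideal.absNorm (ψ x) ∧ Squarefree (Ideal.absNorm (ψ x)) ∧
      ρ x ∈ P0.powersetCard (n + 2) ∧ (∀ p ∈ ρ x, p.Prime) := by
    intro x hx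
    obtain ⟨hm, hP, hQp, hQ0, hpr, hneN, -, -, -, hτQ, hQ1⟩ := hmemb x hx
    obtain ⟨hσsub, hσcard, hσprod, hσsq⟩ := tuple_normset_props hX1 hτ hτ1' hm hP
    have hnotin : Ideal.absNorm x.2 ∉ (univ : Finset (Fin (n + 1))).image (fun j => Ideal.absNorm (x.1.2 j)) := by
      intro h; obtain ⟨j, -, hj⟩ := mem_image.mp h; exact hneN j hj.symm
    have hprodρ : (∏ p ∈ ρ x, p) = Ideal.absNorm (ψ x) := by
      simp only [hρ, hψ]
      rw [prod_insert hnotin, hσprod, map_mul]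
    have hcop : (Ideal.absNorm x.2).Coprime (Ideal.absNorm (∏ j, x.1.2 j)) := by
      rw [← hσprod]
      refine Nat.Coprime.prod_right fun p hp => ?_
      obtain ⟨j, -, rfl⟩ := mem_image.mp hp
      exact (Nat.coprime_primes hpr (mem_P0_iff.mp (hσsub hp)).1).mpr (hneN j)
    refine ⟨hprodρ, ?_, ?_, ?_⟩
    · simp only [hψ]; rw [map_mul]
      exact (Nat.squarefree_mul hcop).mpr ⟨hpr.prime.squarefree, hσsq⟩
    · rw [mem_powersetCard]
      refine ⟨?_, ?_⟩
      · intro p hp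
        simp only [hρ] at hp
        rcases mem_insert.mp hp with rfl | hp
        · exact mem_P0_iff.mpr ⟨hpr, hτQ, hQ1⟩
        · exact hσsub hp
      · simp only [hρ]; rw [card_insert_of_notMem hnotin, hσcard]
    · intro p hp
      simp only [hρ] at hp
      rcases mem_insert.mp hp with rfl | hp
      · exact hpr
      · exact (mem_P0_iff.mp (hσsub hp)).1
  -- step 1: re-index
  have step1 : ∑ x ∈ PP, (famSifted E I (ψ x) (X ^ τ) : ℝ) = ∑ J ∈ PP.image ψ, (famSifted E I J (X ^ τ) : ℝ) := by
    rw [sum_image hinj]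
  -- step 2: Lemma 7.1 on `[X^{1+2τ}, X^{2−2τ})` at level `X^τ`
  set a : ℝ := X ^ (1 + 2 * τ) with ha
  set b : ℝ := X ^ (2 - 2 * τ) with hb
  have ha2 : 2 ≤ a := by
    have : X ^ (1 : ℝ) ≤ a := Real.rpow_le_rpow_of_exponent_le hX1.le (by linarith)
    rw [Real.rpow_one] at this; linarith
  have hab : a ≤ b := Real.rpow_le_rpow_of_exponent_le hX1.le (by linarith)
  have hmin : min (X ^ τ) (X ^ (2 - τ) / b) = X ^ τ := by
    have : X ^ (2 - τ) / b = X ^ τ := by rw [hb, ← Real.rpow_sub hX0]; ring_nf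
    rw [this, min_self]
  have hXτ1 : 1 < X ^ τ := Real.one_lt_rpow hX1 hτ
  have hm1 : 1 < min (X ^ τ) (X ^ (2 - τ) / b) := by rw [hmin]; exact hXτ1
  have hlogmin : Real.log (min (X ^ τ) (X ^ (2 - τ) / b)) = τ * L := by rw [hmin, Real.log_rpow hX0]
  have h7z : ∀ (N : ℝ) (𝒬 : Finset ℕ), 0 < N → N ≤ X ^ (2 - 2 * τ) →
      (∀ q ∈ 𝒬, Squarefree q ∧ N < q ∧ (q : ℝ) ≤ 2 * N) →
      ∑ Q ∈ normIn 𝒬, (famSifted E I Q (X ^ τ) : ℝ) ≤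
        C₇ * (M / Real.log (min (X ^ τ) (X ^ (2 - τ) / N)) *
          ∑ Q ∈ normIn 𝒬, ((Ideal.absNorm Q : ℕ) : ℝ)⁻¹ + Err) :=
    fun N 𝒬 hN hNX h𝒬 => h7 N (X ^ τ) 𝒬 le_rfl hN hNX h𝒬
  have hTimg : ∀ J ∈ PP.image ψ, Squarefree (Ideal.absNorm J) ∧ a ≤ (Ideal.absNorm J : ℝ) ∧
      (Ideal.absNorm J : ℝ) < b := by
    intro J hJ
    obtain ⟨x, hx, rfl⟩ := mem_image.mp hJ
    obtain ⟨hm, hP, -, -, -, -, hreg, -, -, hτQ, -⟩ := hmemb x hx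
    obtain ⟨-, hsq, -, -⟩ := hnorm x hx
    obtain ⟨-, -, -, -, -, hlow, -⟩ := U_index_props hX1 hτ hτ1' hm hP
    refine ⟨hsq, ?_, ?_⟩
    · simp only [hψ]; rw [map_mul, Nat.cast_mul, ha]
      have hNprod : (Ideal.absNorm (∏ j, x.1.2 j) : ℝ) = ∏ j, (Ideal.absNorm (x.1.2 j) : ℝ) := by
        rw [map_prod, Nat.cast_prod]
      calc X ^ (1 + 2 * τ) = X ^ τ * X ^ (1 + τ) := by rw [← Real.rpow_add hX0]; ring_nf
        _ ≤ (Ideal.absNorm x.2 : ℝ) * Ideal.absNorm (∏ j, x.1.2 j) := by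
            rw [hNprod]
            exact mul_le_mul hτQ hlow (Real.rpow_nonneg hX0.le _) (Nat.cast_nonneg _)
    · simp only [hψ]; rw [map_mul, Nat.cast_mul, hb]; exact hreg
  have step2 := sum_le_of_image_normIn (fun J => Nat.cast_nonneg _) h7z hC₇ hM hErr hX0 ha2 hab le_rfl hm1
    (PP.image ψ) hTimg
  rw [hlogmin] at step2
  -- step 3: the weight through patterns
  have step3 : ∑ q ∈ (PP.image ψ).image Ideal.absNorm, (idealNormCount K q : ℝ) * (q : ℝ)⁻¹ ≤
      ∑ σ ∈ PP.image ρ, ∏ p ∈ σ, (idealNormCount K p : ℝ) * (p : ℝ)⁻¹ := by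
    have heq : (PP.image ψ).image Ideal.absNorm = (PP.image ρ).image (fun σ => ∏ p ∈ σ, p) := by
      rw [image_image, image_image]
      exact image_congr fun x hx => by simp only [Function.comp_apply]; exact ((hnorm x hx).1).symm
    rw [heq]
    exact sum_image_prod_normWt_le _ fun σ hσ p hp => by
      obtain ⟨x, hx, rfl⟩ := mem_image.mp hσ
      exact (hnorm x hx).2.2.2 p hp
  -- step 4: the close class
  have hP0mem : ∀ p ∈ P0, p.Prime ∧ X ^ τ ≤ (p : ℝ) := fun p hp =>
    ⟨(mem_P0_iff.mp hp).1, (mem_P0_iff.mp hp).2.1⟩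
  have hρe : (1 : ℝ) ≤ X ^ hbXi τ := Real.one_le_rpow hX1.le (hbXi_pos hτ).le
  have step4 := sum_class_close_le P0 hC₁ hwin hX1 hτ hXτ hP0mem (PP.image ρ)
    (fun σ hσ => by obtain ⟨x, hx, rfl⟩ := mem_image.mp hσ; exact (hnorm x hx).2.2.1) hρe
    (fun σ hσ => by
      obtain ⟨x, hx, rfl⟩ := mem_image.mp hσ
      obtain ⟨-, -, -, -, -, -, -, hNlt, hclose, -⟩ := hmemb x hx
      refine ⟨Ideal.absNorm x.2, by simp only [hρ]; exact mem_insert_self _ _,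
        Ideal.absNorm (x.1.2 (Fin.last n)), ?_, hNlt, hclose.le⟩
      simp only [hρ]
      exact mem_insert_of_mem (mem_image_of_mem _ (mem_univ _)))
  rw [Real.log_rpow hX0] at step4
  -- combine
  have hblocks : Real.log b / Real.log 2 + 1 ≤ 3 * L := by
    refine log_div_log_two_add_one_le (by linarith) ?_ hL hL10
    calc b ≤ X ^ ((2 : ℕ) : ℝ) := Real.rpow_le_rpow_of_exponent_le hX1.le (by norm_num; linarith)
      _ = X ^ 2 := Real.rpow_natCast X 2
  have hcoef : 0 ≤ C₇ * (M / (τ * L)) := by positivity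
  calc ∑ x ∈ PP, (famSifted E I (x.2 * ∏ j, x.1.2 j) (X ^ τ) : ℝ)
      = ∑ J ∈ PP.image ψ, (famSifted E I J (X ^ τ) : ℝ) := step1
    _ ≤ C₇ * (M / (τ * L) * ∑ q ∈ (PP.image ψ).image Ideal.absNorm, (idealNormCount K q : ℝ) * (q : ℝ)⁻¹) +
          (Real.log b / Real.log 2 + 1) * (C₇ * Err) := step2
    _ ≤ C₇ * (M / (τ * L)) * ((∑ p ∈ P0, (idealNormCount K p : ℝ) * (p : ℝ)⁻¹) *
            (2 * (hbXi τ * L + C₁) / (τ * L)) *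
            ∑ σ' ∈ P0.powersetCard n, ∏ p ∈ σ', (idealNormCount K p : ℝ) * (p : ℝ)⁻¹) +
          3 * L * (C₇ * Err) := by
        rw [← mul_assoc]
        exact add_le_add (mul_le_mul_of_nonneg_left (step3.trans step4) hcoef)
          (mul_le_mul_of_nonneg_right hblocks (by positivity))

end E3r1bound

section E3r2

variable {ι : Type*} (E : Finset ι) (I : ι → Ideal (𝓞 K)) {X τ CN : ℝ} {n : ℕ}

/-- **Few prime factors in regime 2.** If every prime ideal factor of a nonzero `J` has norm
`> X^{1/2−2τ}`, `N(J) ≤ C_N X³` with `C_N < X^{3τ}` and `τ ≤ 1/40`, then `J` has at most `6` prime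
ideal factors (their product divides `J`). [folklore] -/
theorem card_primeFactorsFinset_le_six (hX : 1 < X) (hτ : 0 < τ) (hτ1 : τ ≤ 1 / 40)
    (hCN : CN < X ^ (3 * τ)) {J : Ideal (𝓞 K)} (hJ : J ≠ ⊥)
    (hNJ : (Ideal.absNorm J : ℝ) ≤ CN * X ^ 3)
    (hrough : ∀ P ∈ primeFactorsFinset J, X ^ (1 / 2 - 2 * τ) < (Ideal.absNorm P : ℝ)) :
    #(primeFactorsFinset J) ≤ 6 := by
  classical
  have hX0 : 0 < X := by linarith
  set pf := primeFactorsFinset J with hpf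
  have hmem := fun P (hP : P ∈ pf) => (mem_primeFactorsFinset_iff hJ).mp hP
  have hdvd : ∏ P ∈ pf, P ∣ J :=
    Finset.prod_primes_dvd J (fun P hP => Ideal.prime_of_isPrime (ne_bot_of_mem_primeFactorsFinset hJ hP) (hmem P hP).1)
      fun P hP => (hmem P hP).2
  have hNle : (∏ P ∈ pf, (Ideal.absNorm P : ℝ)) ≤ Ideal.absNorm J := by
    have h1 : Ideal.absNorm (∏ P ∈ pf, P) ∣ Ideal.absNorm J := Ideal.absNorm_dvd_absNorm_of_le (Ideal.le_of_dvd hdvd)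
    have hJ0 : Ideal.absNorm J ≠ 0 := fun h => hJ (Ideal.absNorm_eq_zero_iff.mp h)
    have h2 := Nat.le_of_dvd (Nat.pos_of_ne_zero hJ0) h1
    rw [absNorm_prod] at h2
    exact_mod_cast h2
  by_contra hgt
  push Not at hgt
  -- `X^{(1/2 − 2τ)·7} ≤ ∏ N(P) ≤ C_N X³ < X^{3+3τ}`
  have hlow : (X ^ (1 / 2 - 2 * τ)) ^ #pf ≤ ∏ P ∈ pf, (Ideal.absNorm P : ℝ) := by
    rw [← prod_const]
    exact prod_le_prod (fun _ _ => Real.rpow_nonneg hX0.le _) fun P hP => (hrough P hP).le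
  have hbase : 1 ≤ X ^ (1 / 2 - 2 * τ) := Real.one_le_rpow hX.le (by linarith)
  have h7 : (X ^ (1 / 2 - 2 * τ)) ^ 7 ≤ (X ^ (1 / 2 - 2 * τ)) ^ #pf :=
    pow_le_pow_right₀ hbase (by omega)
  have h7' : (X ^ (1 / 2 - 2 * τ)) ^ 7 = X ^ (7 / 2 - 14 * τ) := by
    rw [← Real.rpow_natCast, ← Real.rpow_mul hX0.le]; ring_nf
  have hup : CN * X ^ 3 < X ^ (3 + 3 * τ) := by
    rw [pow_three_eq_rpow, show (3 : ℝ) + 3 * τ = 3 * τ + 3 by ring, Real.rpow_add hX0]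
    exact mul_lt_mul_of_pos_right hCN (Real.rpow_pos_of_pos hX0 _)
  have hexp : X ^ (3 + 3 * τ) ≤ X ^ (7 / 2 - 14 * τ) := Real.rpow_le_rpow_of_exponent_le hX.le (by linarith)
  linarith

open scoped Classical in
/-- **(E3), regime `N(Q·∏P_i) ≥ X^{2−2τ}`: bounded multiplicity.** The triples `((𝐦,P), Q, i)` of
the Buchstab range in this regime (possible only when `N(Q) > X^{1/2−τ}`, whence `I_i` has at most
`6` prime factors) are counted through the pair `(Q·P_{n+1}, i)`: for fixed `i` and `D = Q·P_{n+1}`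
the remaining primes `{P_1,…,P_n}` form an `n`-subset of the prime factors of `I_i`, so the
multiplicity is `≤ C(6,n) ≤ 20`, and `∑ #{i : Q∏P_i ∣ I_i, I_i rough} ≤ 20 ∑_D S_K(𝒵_D, X^τ)` over
the ideals `D = Q·P_{n+1}`. [cite: HeathBrownActa2001, §7 pp. 44, 47] -/
theorem E3_regime2_count_le (hX : 1 < X) (hτ : 0 < τ) (hτ1 : τ ≤ 1 / 40) (hCN : CN < X ^ (3 * τ))
    (hE : ∀ i ∈ E, I i ≠ ⊥ ∧ (Ideal.absNorm (I i) : ℝ) ≤ CN * X ^ 3) :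
    ∑ x ∈ ((mIndexU τ n).sigma (fun m => Fintype.piFinset fun i => Jprimes X τ (m i))).sigma (fun b =>
        ((idealsLE (Ideal.absNorm (b.2 (Fin.last n)))).filter
          (fun Q => Q.IsPrime ∧ Q ≠ ⊥ ∧ X ^ ((b.1 (Fin.last n) : ℝ) * hbXi τ) ≤ (Ideal.absNorm Q : ℝ) ∧
            PrimeLT Q (b.2 (Fin.last n)))).filter
          (fun Q => (Ideal.absNorm Q).Prime ∧ (∀ j, Ideal.absNorm Q ≠ Ideal.absNorm (b.2 j)) ∧
            X ^ (2 - 2 * τ) ≤ (Ideal.absNorm Q : ℝ) * Ideal.absNorm (∏ j, b.2 j))),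
        (#{i ∈ E | (x.2 * ∏ j, x.1.2 j) ∣ I i ∧ IsRough (X ^ ((x.1.1 (Fin.last n) : ℝ) * hbXi τ)) (I i)} : ℝ) ≤
      20 * ∑ D ∈ (((mIndexU τ n).sigma (fun m => Fintype.piFinset fun i => Jprimes X τ (m i))).sigma (fun b =>
        ((idealsLE (Ideal.absNorm (b.2 (Fin.last n)))).filter
          (fun Q => Q.IsPrime ∧ Q ≠ ⊥ ∧ X ^ ((b.1 (Fin.last n) : ℝ) * hbXi τ) ≤ (Ideal.absNorm Q : ℝ) ∧
            PrimeLT Q (b.2 (Fin.last n)))).filter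
          (fun Q => (Ideal.absNorm Q).Prime ∧ (∀ j, Ideal.absNorm Q ≠ Ideal.absNorm (b.2 j)) ∧
            X ^ (2 - 2 * τ) ≤ (Ideal.absNorm Q : ℝ) * Ideal.absNorm (∏ j, b.2 j)))).image
          (fun x => x.2 * x.1.2 (Fin.last n)),
        (famSifted E I D (X ^ τ) : ℝ) := by
  classical
  have hX0 : 0 < X := by linarith
  have hτ1' : τ ≤ 1 := by linarith
  have hξ := hbXi_pos hτ
  have hξτ : hbXi τ ≤ τ := hbXi_le hτ.le hτ1'
  set A : Finset (Σ _ : Fin (n + 1) → ℕ, Fin (n + 1) → Ideal (𝓞 K)) :=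
    (mIndexU τ n).sigma (fun m => Fintype.piFinset fun i => Jprimes X τ (m i)) with hA
  set PP := A.sigma (fun b =>
        ((idealsLE (Ideal.absNorm (b.2 (Fin.last n)))).filter
          (fun Q => Q.IsPrime ∧ Q ≠ ⊥ ∧ X ^ ((b.1 (Fin.last n) : ℝ) * hbXi τ) ≤ (Ideal.absNorm Q : ℝ) ∧
            PrimeLT Q (b.2 (Fin.last n)))).filter
          (fun Q => (Ideal.absNorm Q).Prime ∧ (∀ j, Ideal.absNorm Q ≠ Ideal.absNorm (b.2 j)) ∧
            X ^ (2 - 2 * τ) ≤ (Ideal.absNorm Q : ℝ) * Ideal.absNorm (∏ j, b.2 j))) with hPP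
  set ψ : (Σ _ : (Σ _ : Fin (n + 1) → ℕ, Fin (n + 1) → Ideal (𝓞 K)), Ideal (𝓞 K)) → Ideal (𝓞 K) :=
    fun x => x.2 * ∏ j, x.1.2 j with hψ
  set δ : (Σ _ : (Σ _ : Fin (n + 1) → ℕ, Fin (n + 1) → Ideal (𝓞 K)), Ideal (𝓞 K)) → Ideal (𝓞 K) :=
    fun x => x.2 * x.1.2 (Fin.last n) with hδ
  set zz : (Σ _ : (Σ _ : Fin (n + 1) → ℕ, Fin (n + 1) → Ideal (𝓞 K)), Ideal (𝓞 K)) → ℝ :=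
    fun x => X ^ ((x.1.1 (Fin.last n) : ℝ) * hbXi τ) with hzz
  set 𝒟 := PP.image δ with h𝒟
  -- unpack a member
  have hmemb : ∀ x ∈ PP, x.1.1 ∈ mIndexU τ n ∧ (x.1.2 ∈ Fintype.piFinset fun i => Jprimes X τ (x.1.1 i)) ∧
      x.2.IsPrime ∧ x.2 ≠ ⊥ ∧ (∀ j, x.2 ≠ x.1.2 j) ∧
      (∀ j, Ideal.absNorm x.2 < Ideal.absNorm (x.1.2 j)) ∧
      X ^ (1 / 2 - 2 * τ) < zz x ∧ X ^ τ ≤ zz x ∧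
      (∀ j, (x.1.2 j).IsPrime ∧ x.1.2 j ≠ ⊥) ∧ (StrictAnti fun j => Ideal.absNorm (x.1.2 j)) := by
    rintro ⟨⟨m, P⟩, Q⟩ hx
    simp only [hPP, hA, mem_sigma, mem_filter] at hx
    obtain ⟨⟨hm, hP⟩, ⟨-, hQp, hQ0, hzQ, hlt⟩, hpr, hneN, hreg⟩ := hx
    obtain ⟨-, hJ, -, hSA, -, -, hup, -, -, hτz⟩ := U_index_props hX hτ hτ1' hm hP
    obtain ⟨hne, -, hNle, hclose, hτQ, hQ1⟩ := buchstab_prime_props hX hτ hτ1' hm hP hQp hQ0 hzQ hlt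
    have hNlt : ∀ j, Ideal.absNorm Q < Ideal.absNorm (P j) := fun j => by
      have h1 : Ideal.absNorm Q ≤ Ideal.absNorm (P (Fin.last n)) := by exact_mod_cast hNle
      exact lt_of_le_of_ne (h1.trans (hSA.antitone (Fin.le_last j))) (hneN j)
    refine ⟨hm, hP, hQp, hQ0, hne, hNlt, ?_, hτz, fun j => ⟨(hJ j).1, (hJ j).2.1⟩, hSA⟩
    -- `z > N(Q) X^{-ξ} > X^{1/2−τ−ξ} ≥ X^{1/2−2τ}`
    simp only [hzz]
    have hNprod : (Ideal.absNorm (∏ j, P j) : ℝ) = ∏ j, (Ideal.absNorm (P j) : ℝ) := by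
      rw [map_prod, Nat.cast_prod]
    have hS : (Ideal.absNorm (∏ j, P j) : ℝ) < X ^ (3 / 2 - τ) := by rw [hNprod]; exact hup
    have hSpos : 0 < (Ideal.absNorm (∏ j, P j) : ℝ) := by
      rw [hNprod]; exact prod_pos fun j _ => by exact_mod_cast (hJ j).2.2.1.pos
    have hQlow : X ^ (1 / 2 - τ) < (Ideal.absNorm Q : ℝ) := by
      by_contra hle
      push Not at hle
      have : (Ideal.absNorm Q : ℝ) * Ideal.absNorm (∏ j, P j) < X ^ (1 / 2 - τ) * X ^ (3 / 2 - τ) :=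
        mul_lt_mul' hle hS hSpos.le (Real.rpow_pos_of_pos hX0 _)
      rw [← Real.rpow_add hX0] at this
      have e : 1 / 2 - τ + (3 / 2 - τ) = 2 - 2 * τ := by ring
      rw [e] at this
      linarith
    -- `N(P_last) < N(Q) X^ξ` and `z X^ξ = X^{(m+1)ξ} > N(P_last) ≥ N(Q)`... use `z ≥ N(P_last) X^{-ξ}`
    have hzlow : (Ideal.absNorm (P (Fin.last n)) : ℝ) < X ^ ((m (Fin.last n) : ℝ) * hbXi τ) * X ^ hbXi τ := by
      rw [← Real.rpow_add hX0]
      have := (hJ (Fin.last n)).2.2.2.2; ring_nf at this ⊢; exact this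
    have hQle : (Ideal.absNorm Q : ℝ) ≤ Ideal.absNorm (P (Fin.last n)) := hNle
    have hXξ : 0 < X ^ hbXi τ := Real.rpow_pos_of_pos hX0 _
    have h1 : X ^ (1 / 2 - τ) < X ^ ((m (Fin.last n) : ℝ) * hbXi τ) * X ^ hbXi τ := by linarith
    have h2 : X ^ (1 / 2 - 2 * τ) * X ^ hbXi τ ≤ X ^ (1 / 2 - τ) := by
      rw [← Real.rpow_add hX0]; exact Real.rpow_le_rpow_of_exponent_le hX.le (by linarith)
    nlinarith
  -- `δ x ∣ ψ x`
  have hδψ : ∀ x ∈ PP, δ x ∣ ψ x := fun x _ => by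
    simp only [hδ, hψ]
    exact mul_dvd_mul_left _ (dvd_prod_of_mem _ (mem_univ _))
  -- the fibre bound
  have hfib : ∀ i ∈ E, ∀ D ∈ 𝒟,
      (#((PP.filter fun x => ψ x ∣ I i ∧ IsRough (zz x) (I i)).filter fun x => δ x = D) : ℝ) ≤
        20 * (if D ∣ I i ∧ IsRough (X ^ τ) (I i) then 1 else 0) := by
    intro i hi D hD
    set F := (PP.filter fun x => ψ x ∣ I i ∧ IsRough (zz x) (I i)).filter fun x => δ x = D with hF
    by_cases hFe : F = ∅
    · rw [hFe, card_empty, Nat.cast_zero]; positivity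
    obtain ⟨x₀, hx₀⟩ := nonempty_iff_ne_empty.mpr hFe
    have hx₀F := hx₀
    rw [hF, mem_filter, mem_filter] at hx₀
    obtain ⟨⟨hx₀P, hψ₀, hr₀⟩, hδ₀⟩ := hx₀
    obtain ⟨hI0, hIN⟩ := hE i hi
    -- the indicator is `1`
    have hind : (if D ∣ I i ∧ IsRough (X ^ τ) (I i) then (1 : ℝ) else 0) = 1 := by
      rw [if_pos]
      exact ⟨hδ₀ ▸ (hδψ x₀ hx₀P).trans hψ₀, hr₀.mono (hmemb x₀ hx₀P).2.2.2.2.2.2.2.1⟩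
    rw [hind, mul_one]
    -- prime factors of `I i` are few
    set pf := primeFactorsFinset (I i) with hpf
    have hpf6 : #pf ≤ 6 := by
      refine card_primeFactorsFinset_le_six hX hτ hτ1 hCN hI0 hIN fun P hP => ?_
      obtain ⟨hPp, hPd⟩ := (mem_primeFactorsFinset_iff hI0).mp hP
      exact (hmemb x₀ hx₀P).2.2.2.2.2.2.1.trans_le (hr₀ hPp hPd)
    -- the injection into `n`-subsets of `pf`
    set g : (Σ _ : (Σ _ : Fin (n + 1) → ℕ, Fin (n + 1) → Ideal (𝓞 K)), Ideal (𝓞 K)) → Finset (Ideal (𝓞 K)) :=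
      fun x => (univ : Finset (Fin n)).image (fun k => x.1.2 (Fin.castSucc k)) with hg
    have hgmaps : ∀ x ∈ F, g x ∈ pf.powersetCard n := by
      intro x hx
      rw [hF, mem_filter, mem_filter] at hx
      obtain ⟨⟨hxP, hψx, -⟩, -⟩ := hx
      obtain ⟨-, -, -, -, -, -, -, -, hPp, hSA⟩ := hmemb x hxP
      rw [mem_powersetCard]
      refine ⟨fun P hP => ?_, (image_castSucc_props hSA).2.1⟩
      obtain ⟨k, -, rfl⟩ := mem_image.mp hP
      refine (mem_primeFactorsFinset_iff hI0).mpr ⟨(hPp _).1, ?_⟩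
      refine dvd_trans ?_ hψx
      simp only [hψ]
      exact (dvd_prod_of_mem _ (mem_univ _)).trans (dvd_mul_left _ _)
    have hginj : Set.InjOn g F := by
      intro x hx x' hx' hgg
      rw [mem_coe, hF, mem_filter, mem_filter] at hx hx'
      obtain ⟨⟨hxP, -, -⟩, hδx⟩ := hx
      obtain ⟨⟨hxP', -, -⟩, hδx'⟩ := hx'
      obtain ⟨hm, hP, hQp, hQ0, hne, hNlt, -, -, hPp, hSA⟩ := hmemb x hxP
      obtain ⟨hm', hP', hQp', hQ0', hne', hNlt', -, -, hPp', hSA'⟩ := hmemb x' hxP'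
      have hDD : x.2 * x.1.2 (Fin.last n) = x'.2 * x'.1.2 (Fin.last n) := by
        simp only [hδ] at hδx hδx'; rw [hδx, hδx']
      -- the prime factor sets `{Q, P_last}` agree
      have hsets : ({x.2, x.1.2 (Fin.last n)} : Finset (Ideal (𝓞 K))) = {x'.2, x'.1.2 (Fin.last n)} := by
        refine eq_of_prod_eq_prod ?_ ?_ ?_
        · intro P hP; simp only [mem_insert, mem_singleton] at hP
          rcases hP with rfl | rfl
          · exact ⟨hQp, hQ0⟩
          · exact hPp _
        · intro P hP; simp only [mem_insert, mem_singleton] at hP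
          rcases hP with rfl | rfl
          · exact ⟨hQp', hQ0'⟩
          · exact hPp' _
        · rw [prod_pair (hne _), prod_pair (hne' _), hDD]
      have hQQ : x.2 = x'.2 ∧ x.1.2 (Fin.last n) = x'.1.2 (Fin.last n) := by
        have h1 : x.2 ∈ ({x'.2, x'.1.2 (Fin.last n)} : Finset (Ideal (𝓞 K))) := by
          rw [← hsets]; exact mem_insert_self _ _
        have h2 : x.1.2 (Fin.last n) ∈ ({x'.2, x'.1.2 (Fin.last n)} : Finset (Ideal (𝓞 K))) := by
          rw [← hsets]; exact mem_insert_of_mem (mem_singleton_self _)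
        simp only [mem_insert, mem_singleton] at h1 h2
        rcases h1 with h1 | h1
        · refine ⟨h1, ?_⟩
          rcases h2 with h2 | h2
          · exact absurd (h1.trans h2.symm) (hne _)
          · exact h2
        · exfalso
          rcases h2 with h2 | h2
          · have e1 := hNlt (Fin.last n)
            have e2 := hNlt' (Fin.last n)
            rw [h2] at e1; rw [← h1] at e2
            omega
          · exact (hne _ (h1.trans h2.symm)).elim
      -- hence the tuples agree
      have hpair : ((univ : Finset (Fin n)).image (fun k => x.1.2 (Fin.castSucc k)), x.1.2 (Fin.last n)) =
          ((univ : Finset (Fin n)).image (fun k => x'.1.2 (Fin.castSucc k)), x'.1.2 (Fin.last n)) := by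
        rw [Prod.mk.injEq]; exact ⟨hgg, hQQ.2⟩
      have hb : x.1 = x'.1 := by
        have := toPair_injOn (n := n) hX hτ hτ1' (by rw [mem_coe, mem_sigma]; exact ⟨hm, hP⟩)
          (by rw [mem_coe, mem_sigma]; exact ⟨hm', hP'⟩) hpair
        exact this
      obtain ⟨b, Q⟩ := x
      obtain ⟨b', Q'⟩ := x'
      simp only at hb hQQ
      obtain ⟨hQ, -⟩ := hQQ
      subst hb; subst hQ; rfl
    calc (#F : ℝ) ≤ #(pf.powersetCard n) := by exact_mod_cast card_le_card_of_injOn g hgmaps hginj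
      _ = ((#pf).choose n : ℕ) := by rw [card_powersetCard]
      _ ≤ ((6 : ℕ).choose n : ℕ) := by exact_mod_cast Nat.choose_le_choose n hpf6
      _ ≤ ((6 : ℕ).choose (6 / 2) : ℕ) := by exact_mod_cast Nat.choose_le_middle n 6
      _ = 20 := by norm_num [Nat.choose]
  -- double counting
  have hswap : ∑ x ∈ PP, (#{i ∈ E | ψ x ∣ I i ∧ IsRough (zz x) (I i)} : ℝ) =
      ∑ i ∈ E, (#(PP.filter fun x => ψ x ∣ I i ∧ IsRough (zz x) (I i)) : ℝ) := by
    calc ∑ x ∈ PP, (#{i ∈ E | ψ x ∣ I i ∧ IsRough (zz x) (I i)} : ℝ)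
        = ∑ x ∈ PP, ∑ i ∈ E, (if ψ x ∣ I i ∧ IsRough (zz x) (I i) then (1 : ℝ) else 0) :=
          sum_congr rfl fun x _ => by rw [sum_boole]
      _ = ∑ i ∈ E, ∑ x ∈ PP, (if ψ x ∣ I i ∧ IsRough (zz x) (I i) then (1 : ℝ) else 0) := sum_comm
      _ = ∑ i ∈ E, (#(PP.filter fun x => ψ x ∣ I i ∧ IsRough (zz x) (I i)) : ℝ) :=
          sum_congr rfl fun i _ => by rw [sum_boole]
  have hfiber : ∀ i ∈ E, (#(PP.filter fun x => ψ x ∣ I i ∧ IsRough (zz x) (I i)) : ℝ) ≤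
      20 * ∑ D ∈ 𝒟, (if D ∣ I i ∧ IsRough (X ^ τ) (I i) then (1 : ℝ) else 0) := by
    intro i hi
    rw [card_eq_sum_card_fiberwise (f := δ) (t := 𝒟) (fun x hx => mem_image_of_mem _ (mem_filter.mp hx).1),
      Nat.cast_sum, mul_sum]
    exact sum_le_sum fun D hD => hfib i hi D hD
  have hind : ∀ D ∈ 𝒟, ∑ i ∈ E, (if D ∣ I i ∧ IsRough (X ^ τ) (I i) then (1 : ℝ) else 0) =
      (famSifted E I D (X ^ τ) : ℝ) := by
    intro D _
    rw [famSifted, ← sum_filter, sum_const, nsmul_eq_mul, mul_one]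
  calc ∑ x ∈ PP, (#{i ∈ E | ψ x ∣ I i ∧ IsRough (zz x) (I i)} : ℝ)
      = ∑ i ∈ E, (#(PP.filter fun x => ψ x ∣ I i ∧ IsRough (zz x) (I i)) : ℝ) := hswap
    _ ≤ ∑ i ∈ E, 20 * ∑ D ∈ 𝒟, (if D ∣ I i ∧ IsRough (X ^ τ) (I i) then (1 : ℝ) else 0) := sum_le_sum hfiber
    _ = 20 * ∑ D ∈ 𝒟, ∑ i ∈ E, (if D ∣ I i ∧ IsRough (X ^ τ) (I i) then (1 : ℝ) else 0) := by
        rw [← mul_sum, sum_comm]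
    _ = 20 * ∑ D ∈ 𝒟, (famSifted E I D (X ^ τ) : ℝ) := by rw [sum_congr rfl hind]

end E3r2

section E3assembly

variable {ι : Type*} (E : Finset ι) (I : ι → Ideal (𝓞 K)) {X τ CN C₇ C₁ M Err : ℝ} {n : ℕ}

open scoped Classical in
/-- **(E3), regime 2, through Lemma 7.1**: the ideals `D = Q·P_{n+1}` have square-free norms `qp`
with `q < p < qX^ξ` in `[X^{2τ}, X^{2−2τ})`, so `∑_D S_K(𝒵_D, X^τ) ≤ C₇ (M/(τ log X)) (∑_{P0} w) B_ξ + 3 log X · C₇ Err`,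
`B_ξ = 2(ξ log X + C₁)/(τ log X)`. [cite: HeathBrownActa2001, §7 p. 47] -/
theorem E3_regime2_Dsum_le (hC₁ : 0 ≤ C₁)
    (hwin : ∀ (lo hi : ℝ) (T : Finset ℕ), 2 ≤ lo → lo ≤ hi →
      (∀ p ∈ T, p.Prime ∧ lo < (p : ℝ) ∧ (p : ℝ) ≤ hi) →
      ∑ p ∈ T, (idealNormCount K p : ℝ) * (p : ℝ)⁻¹ ≤
        Real.log (Real.log hi / Real.log lo) + C₁ / Real.log lo)
    (hX : (2 : ℝ) ^ 15 ≤ X) (hτ : 0 < τ) (hτ1 : τ ≤ 1 / 8) (hXτ : 4 ≤ X ^ τ)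
    (hC₇ : 0 ≤ C₇) (hM : 0 ≤ M) (hErr : 0 ≤ Err)
    (h7 : ∀ (N z : ℝ) (𝒬 : Finset ℕ), X ^ τ ≤ z → 0 < N → N ≤ X ^ (2 - 2 * τ) →
        (∀ q ∈ 𝒬, Squarefree q ∧ N < q ∧ (q : ℝ) ≤ 2 * N) →
        ∑ Q ∈ normIn 𝒬, (famSifted E I Q z : ℝ) ≤
          C₇ * (M / Real.log (min z (X ^ (2 - τ) / N)) *
            ∑ Q ∈ normIn 𝒬, ((Ideal.absNorm Q : ℕ) : ℝ)⁻¹ + Err)) :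
    ∑ D ∈ (((mIndexU τ n).sigma (fun m => Fintype.piFinset fun i => Jprimes X τ (m i))).sigma (fun b =>
        ((idealsLE (Ideal.absNorm (b.2 (Fin.last n)))).filter
          (fun Q => Q.IsPrime ∧ Q ≠ ⊥ ∧ X ^ ((b.1 (Fin.last n) : ℝ) * hbXi τ) ≤ (Ideal.absNorm Q : ℝ) ∧
            PrimeLT Q (b.2 (Fin.last n)))).filter
          (fun Q => (Ideal.absNorm Q).Prime ∧ (∀ j, Ideal.absNorm Q ≠ Ideal.absNorm (b.2 j)) ∧
            X ^ (2 - 2 * τ) ≤ (Ideal.absNorm Q : ℝ) * Ideal.absNorm (∏ j, b.2 j)))).image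
          (fun x => x.2 * x.1.2 (Fin.last n)),
        (famSifted E I D (X ^ τ) : ℝ) ≤
      C₇ * (M / (τ * Real.log X)) *
        ((∑ p ∈ (range (⌊X ^ (1 - τ)⌋₊ + 1)).filter
            (fun p : ℕ => p.Prime ∧ X ^ τ ≤ (p : ℝ) ∧ (p : ℝ) < X ^ (1 - τ)), (idealNormCount K p : ℝ) * (p : ℝ)⁻¹) *
          (2 * (hbXi τ * Real.log X + C₁) / (τ * Real.log X))) +
      3 * Real.log X * (C₇ * Err) := by
  classical
  have hX1 : 1 < X := lt_of_lt_of_le (by norm_num) hX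
  have hX0 : 0 < X := by linarith
  have hτ1' : τ ≤ 1 := by linarith
  set L := Real.log X with hL
  have hL10 : 10 ≤ L := ten_le_log hX
  have hL0 : 0 < L := by linarith
  set P0 := (range (⌊X ^ (1 - τ)⌋₊ + 1)).filter
    (fun p : ℕ => p.Prime ∧ X ^ τ ≤ (p : ℝ) ∧ (p : ℝ) < X ^ (1 - τ)) with hP0
  set A : Finset (Σ _ : Fin (n + 1) → ℕ, Fin (n + 1) → Ideal (𝓞 K)) :=
    (mIndexU τ n).sigma (fun m => Fintype.piFinset fun i => Jprimes X τ (m i)) with hA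
  set PP := A.sigma (fun b =>
        ((idealsLE (Ideal.absNorm (b.2 (Fin.last n)))).filter
          (fun Q => Q.IsPrime ∧ Q ≠ ⊥ ∧ X ^ ((b.1 (Fin.last n) : ℝ) * hbXi τ) ≤ (Ideal.absNorm Q : ℝ) ∧
            PrimeLT Q (b.2 (Fin.last n)))).filter
          (fun Q => (Ideal.absNorm Q).Prime ∧ (∀ j, Ideal.absNorm Q ≠ Ideal.absNorm (b.2 j)) ∧
            X ^ (2 - 2 * τ) ≤ (Ideal.absNorm Q : ℝ) * Ideal.absNorm (∏ j, b.2 j))) with hPP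
  set δ : (Σ _ : (Σ _ : Fin (n + 1) → ℕ, Fin (n + 1) → Ideal (𝓞 K)), Ideal (𝓞 K)) → Ideal (𝓞 K) :=
    fun x => x.2 * x.1.2 (Fin.last n) with hδ
  set ρ : (Σ _ : (Σ _ : Fin (n + 1) → ℕ, Fin (n + 1) → Ideal (𝓞 K)), Ideal (𝓞 K)) → Finset ℕ :=
    fun x => {Ideal.absNorm x.2, Ideal.absNorm (x.1.2 (Fin.last n))} with hρ
  set 𝒟 := PP.image δ with h𝒟
  have hmemb : ∀ x ∈ PP, (Ideal.absNorm x.2).Prime ∧ (Ideal.absNorm (x.1.2 (Fin.last n))).Prime ∧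
      Ideal.absNorm x.2 < Ideal.absNorm (x.1.2 (Fin.last n)) ∧
      (Ideal.absNorm (x.1.2 (Fin.last n)) : ℝ) < Ideal.absNorm x.2 * X ^ hbXi τ ∧
      X ^ τ ≤ (Ideal.absNorm x.2 : ℝ) ∧ (Ideal.absNorm x.2 : ℝ) < X ^ (1 - τ) ∧
      X ^ τ ≤ (Ideal.absNorm (x.1.2 (Fin.last n)) : ℝ) ∧ (Ideal.absNorm (x.1.2 (Fin.last n)) : ℝ) < X ^ (1 - τ) := by
    rintro ⟨⟨m, P⟩, Q⟩ hx
    simp only [hPP, hA, mem_sigma, mem_filter] at hx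
    obtain ⟨⟨hm, hP⟩, ⟨-, hQp, hQ0, hzQ, hlt⟩, hpr, hneN, -⟩ := hx
    obtain ⟨-, hJ, hsmall, -⟩ := U_index_props hX1 hτ hτ1' hm hP
    obtain ⟨-, -, hNle, hclose, hτQ, hQ1⟩ := buchstab_prime_props hX1 hτ hτ1' hm hP hQp hQ0 hzQ hlt
    have hs := mem_smallPrimes_iff.mp (hsmall (Fin.last n))
    exact ⟨hpr, (hJ _).2.2.1, lt_of_le_of_ne (by exact_mod_cast hNle) (hneN _), hclose, hτQ, hQ1, hs.2.2.1, hs.2.2.2⟩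
  have hDprops : ∀ x ∈ PP, (∏ p ∈ ρ x, p) = Ideal.absNorm (δ x) ∧ Squarefree (Ideal.absNorm (δ x)) ∧
      ρ x ∈ P0.powersetCard 2 ∧ (∀ p ∈ ρ x, p.Prime) ∧
      X ^ (2 * τ) ≤ (Ideal.absNorm (δ x) : ℝ) ∧ (Ideal.absNorm (δ x) : ℝ) < X ^ (2 - 2 * τ) := by
    intro x hx
    obtain ⟨hq, hp, hqp, -, hτq, hq1, hτp, hp1⟩ := hmemb x hx
    have hne : Ideal.absNorm x.2 ≠ Ideal.absNorm (x.1.2 (Fin.last n)) := hqp.ne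
    have hN : Ideal.absNorm (δ x) = Ideal.absNorm x.2 * Ideal.absNorm (x.1.2 (Fin.last n)) := by
      simp only [hδ]; rw [map_mul]
    refine ⟨by simp only [hρ]; rw [prod_pair hne, hN], ?_, ?_, ?_, ?_, ?_⟩
    · rw [hN]
      exact (Nat.squarefree_mul ((Nat.coprime_primes hq hp).mpr hne)).mpr ⟨hq.prime.squarefree, hp.prime.squarefree⟩
    · rw [mem_powersetCard]
      refine ⟨fun p hp' => ?_, by simp only [hρ]; rw [card_pair hne]⟩
      simp only [hρ, mem_insert, mem_singleton] at hp'
      rcases hp' with rfl | rfl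
      · exact mem_P0_iff.mpr ⟨hq, hτq, hq1⟩
      · exact mem_P0_iff.mpr ⟨hp, hτp, hp1⟩
    · intro p hp'
      simp only [hρ, mem_insert, mem_singleton] at hp'
      rcases hp' with rfl | rfl
      · exact hq
      · exact hp
    · rw [hN, Nat.cast_mul]
      calc X ^ (2 * τ) = X ^ τ * X ^ τ := by rw [← Real.rpow_add hX0]; ring_nf
        _ ≤ _ := mul_le_mul hτq hτp (Real.rpow_nonneg hX0.le _) (Nat.cast_nonneg _)
    · rw [hN, Nat.cast_mul]
      calc (Ideal.absNorm x.2 : ℝ) * Ideal.absNorm (x.1.2 (Fin.last n)) < X ^ (1 - τ) * X ^ (1 - τ) :=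
            mul_lt_mul'' hq1 hp1 (Nat.cast_nonneg _) (Nat.cast_nonneg _)
        _ = X ^ (2 - 2 * τ) := by rw [← Real.rpow_add hX0]; ring_nf
  -- Lemma 7.1 on `[X^{2τ}, X^{2−2τ})` at level `X^τ`
  set a : ℝ := X ^ (2 * τ) with ha
  set b : ℝ := X ^ (2 - 2 * τ) with hb
  have ha2 : 2 ≤ a := by
    have : X ^ τ ≤ a := Real.rpow_le_rpow_of_exponent_le hX1.le (by linarith)
    linarith
  have hab : a ≤ b := Real.rpow_le_rpow_of_exponent_le hX1.le (by linarith)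
  have hmin : min (X ^ τ) (X ^ (2 - τ) / b) = X ^ τ := by
    have : X ^ (2 - τ) / b = X ^ τ := by rw [hb, ← Real.rpow_sub hX0]; ring_nf
    rw [this, min_self]
  have hXτ1 : 1 < X ^ τ := Real.one_lt_rpow hX1 hτ
  have hm1 : 1 < min (X ^ τ) (X ^ (2 - τ) / b) := by rw [hmin]; exact hXτ1
  have hlogmin : Real.log (min (X ^ τ) (X ^ (2 - τ) / b)) = τ * L := by rw [hmin, Real.log_rpow hX0]
  have h7z : ∀ (N : ℝ) (𝒬 : Finset ℕ), 0 < N → N ≤ X ^ (2 - 2 * τ) →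
      (∀ q ∈ 𝒬, Squarefree q ∧ N < q ∧ (q : ℝ) ≤ 2 * N) →
      ∑ Q ∈ normIn 𝒬, (famSifted E I Q (X ^ τ) : ℝ) ≤
        C₇ * (M / Real.log (min (X ^ τ) (X ^ (2 - τ) / N)) *
          ∑ Q ∈ normIn 𝒬, ((Ideal.absNorm Q : ℕ) : ℝ)⁻¹ + Err) :=
    fun N 𝒬 hN hNX h𝒬 => h7 N (X ^ τ) 𝒬 le_rfl hN hNX h𝒬
  have hTimg : ∀ D ∈ 𝒟, Squarefree (Ideal.absNorm D) ∧ a ≤ (Ideal.absNorm D : ℝ) ∧ (Ideal.absNorm D : ℝ) < b := by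
    intro D hD
    obtain ⟨x, hx, rfl⟩ := mem_image.mp hD
    obtain ⟨-, hsq, -, -, hlo, hhi⟩ := hDprops x hx
    exact ⟨hsq, hlo, hhi⟩
  have step2 := sum_le_of_image_normIn (fun J => Nat.cast_nonneg _) h7z hC₇ hM hErr hX0 ha2 hab le_rfl hm1 𝒟 hTimg
  rw [hlogmin] at step2
  have step3 : ∑ q ∈ 𝒟.image Ideal.absNorm, (idealNormCount K q : ℝ) * (q : ℝ)⁻¹ ≤
      ∑ σ ∈ PP.image ρ, ∏ p ∈ σ, (idealNormCount K p : ℝ) * (p : ℝ)⁻¹ := by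
    have heq : 𝒟.image Ideal.absNorm = (PP.image ρ).image (fun σ => ∏ p ∈ σ, p) := by
      rw [h𝒟, image_image, image_image]
      exact image_congr fun x hx => by simp only [Function.comp_apply]; exact ((hDprops x hx).1).symm
    rw [heq]
    exact sum_image_prod_normWt_le _ fun σ hσ p hp => by
      obtain ⟨x, hx, rfl⟩ := mem_image.mp hσ
      exact (hDprops x hx).2.2.2.1 p hp
  have hP0mem : ∀ p ∈ P0, p.Prime ∧ X ^ τ ≤ (p : ℝ) := fun p hp =>
    ⟨(mem_P0_iff.mp hp).1, (mem_P0_iff.mp hp).2.1⟩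
  have hρe : (1 : ℝ) ≤ X ^ hbXi τ := Real.one_le_rpow hX1.le (hbXi_pos hτ).le
  have step4 := sum_class_close_le P0 hC₁ hwin hX1 hτ hXτ hP0mem (n := 0) (PP.image ρ)
    (fun σ hσ => by obtain ⟨x, hx, rfl⟩ := mem_image.mp hσ; exact (hDprops x hx).2.2.1) hρe
    (fun σ hσ => by
      obtain ⟨x, hx, rfl⟩ := mem_image.mp hσ
      obtain ⟨-, -, hqp, hclose, -⟩ := hmemb x hx
      refine ⟨Ideal.absNorm x.2, by simp only [hρ]; exact mem_insert_self _ _,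
        Ideal.absNorm (x.1.2 (Fin.last n)), ?_, hqp, hclose.le⟩
      simp only [hρ]; exact mem_insert_of_mem (mem_singleton_self _))
  rw [Real.log_rpow hX0, powersetCard_zero, sum_singleton, prod_empty, mul_one] at step4
  have hblocks : Real.log b / Real.log 2 + 1 ≤ 3 * L := by
    refine log_div_log_two_add_one_le (by linarith) ?_ hL hL10
    calc b ≤ X ^ ((2 : ℕ) : ℝ) := Real.rpow_le_rpow_of_exponent_le hX1.le (by norm_num; linarith)
      _ = X ^ 2 := Real.rpow_natCast X 2
  have hcoef : 0 ≤ C₇ * (M / (τ * L)) := by positivity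
  calc ∑ D ∈ 𝒟, (famSifted E I D (X ^ τ) : ℝ)
      ≤ C₇ * (M / (τ * L) * ∑ q ∈ 𝒟.image Ideal.absNorm, (idealNormCount K q : ℝ) * (q : ℝ)⁻¹) +
          (Real.log b / Real.log 2 + 1) * (C₇ * Err) := step2
    _ ≤ C₇ * (M / (τ * L)) * ((∑ p ∈ P0, (idealNormCount K p : ℝ) * (p : ℝ)⁻¹) *
            (2 * (hbXi τ * L + C₁) / (τ * L))) + 3 * L * (C₇ * Err) := by
        rw [← mul_assoc]
        exact add_le_add (mul_le_mul_of_nonneg_left (step3.trans step4) hcoef)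
          (mul_le_mul_of_nonneg_right hblocks (by positivity))

end E3assembly

section E3total

variable {ι : Type*} (E : Finset ι) (I : ι → Ideal (𝓞 K)) {X τ CN C₇ C₁ M Err : ℝ} {n : ℕ}

open scoped Classical in
/-- **(E3) estimated.** The raw Buchstab range of `U_abs_sub_le` is at most (E3ii) the family counts
`#𝒵_{Q∏P_i}` over the primes `Q` of the range that are of degree `≥ 2` or share a norm with some
`P_i` (none contribute for `𝒜^(K)`), plus the two Lemma 7.1 bounds of the regimes
`N(Q∏P_i) < X^{2−2τ}` (`E3_regime1_le`) and `≥ X^{2−2τ}` (`E3_regime2_count_le`, `E3_regime2_Dsum_le`):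
`≤ E3ii + C₇ (M/(τ log X)) (∑_{P0} w) B_ξ (e_n + 20) + 63 log X · C₇ Err`.
[cite: HeathBrownActa2001, §7 pp. 44–47] -/
theorem E3_le (hC₁ : 0 ≤ C₁)
    (hwin : ∀ (lo hi : ℝ) (T : Finset ℕ), 2 ≤ lo → lo ≤ hi →
      (∀ p ∈ T, p.Prime ∧ lo < (p : ℝ) ∧ (p : ℝ) ≤ hi) →
      ∑ p ∈ T, (idealNormCount K p : ℝ) * (p : ℝ)⁻¹ ≤
        Real.log (Real.log hi / Real.log lo) + C₁ / Real.log lo)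
    (hX : (2 : ℝ) ^ 15 ≤ X) (hτ : 0 < τ) (hτ1 : τ ≤ 1 / 40) (hXτ : 4 ≤ X ^ τ) (hCN : CN < X ^ (3 * τ))
    (hE : ∀ i ∈ E, I i ≠ ⊥ ∧ (Ideal.absNorm (I i) : ℝ) ≤ CN * X ^ 3)
    (hC₇ : 0 ≤ C₇) (hM : 0 ≤ M) (hErr : 0 ≤ Err)
    (h7 : ∀ (N z : ℝ) (𝒬 : Finset ℕ), X ^ τ ≤ z → 0 < N → N ≤ X ^ (2 - 2 * τ) →
        (∀ q ∈ 𝒬, Squarefree q ∧ N < q ∧ (q : ℝ) ≤ 2 * N) →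
        ∑ Q ∈ normIn 𝒬, (famSifted E I Q z : ℝ) ≤
          C₇ * (M / Real.log (min z (X ^ (2 - τ) / N)) *
            ∑ Q ∈ normIn 𝒬, ((Ideal.absNorm Q : ℕ) : ℝ)⁻¹ + Err)) :
    ∑ b ∈ (mIndexU τ n).sigma (fun m => Fintype.piFinset fun i => Jprimes X τ (m i)),
        ∑ Q ∈ (idealsLE (Ideal.absNorm (b.2 (Fin.last n)))).filter
            (fun Q => Q.IsPrime ∧ Q ≠ ⊥ ∧ X ^ ((b.1 (Fin.last n) : ℝ) * hbXi τ) ≤ (Ideal.absNorm Q : ℝ) ∧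
              PrimeLT Q (b.2 (Fin.last n))),
          (#{i ∈ E | (∏ j, b.2 j) ∣ I i ∧ Q ∣ I i ∧ IsRough (X ^ ((b.1 (Fin.last n) : ℝ) * hbXi τ)) (I i)} : ℝ) ≤
      ∑ b ∈ (mIndexU τ n).sigma (fun m => Fintype.piFinset fun i => Jprimes X τ (m i)),
        ∑ Q ∈ ((idealsLE (Ideal.absNorm (b.2 (Fin.last n)))).filter
            (fun Q => Q.IsPrime ∧ Q ≠ ⊥ ∧ X ^ ((b.1 (Fin.last n) : ℝ) * hbXi τ) ≤ (Ideal.absNorm Q : ℝ) ∧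
              PrimeLT Q (b.2 (Fin.last n)))).filter
            (fun Q => ¬ ((Ideal.absNorm Q).Prime ∧ ∀ j, Ideal.absNorm Q ≠ Ideal.absNorm (b.2 j))),
          (famCount E I (Q * ∏ j, b.2 j) : ℝ) +
      C₇ * (M / (τ * Real.log X)) *
        ((∑ p ∈ (range (⌊X ^ (1 - τ)⌋₊ + 1)).filter
            (fun p : ℕ => p.Prime ∧ X ^ τ ≤ (p : ℝ) ∧ (p : ℝ) < X ^ (1 - τ)), (idealNormCount K p : ℝ) * (p : ℝ)⁻¹) *
          (2 * (hbXi τ * Real.log X + C₁) / (τ * Real.log X)) *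
          (∑ σ' ∈ ((range (⌊X ^ (1 - τ)⌋₊ + 1)).filter
              (fun p : ℕ => p.Prime ∧ X ^ τ ≤ (p : ℝ) ∧ (p : ℝ) < X ^ (1 - τ))).powersetCard n,
            ∏ p ∈ σ', (idealNormCount K p : ℝ) * (p : ℝ)⁻¹ + 20)) +
      63 * Real.log X * (C₇ * Err) := by
  classical
  have hX1 : 1 < X := lt_of_lt_of_le (by norm_num) hX
  have hX0 : 0 < X := by linarith
  have hτ1' : τ ≤ 1 := by linarith
  have hτ8 : τ ≤ 1 / 8 := by linarith
  set L := Real.log X with hL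
  set A : Finset (Σ _ : Fin (n + 1) → ℕ, Fin (n + 1) → Ideal (𝓞 K)) :=
    (mIndexU τ n).sigma (fun m => Fintype.piFinset fun i => Jprimes X τ (m i)) with hA
  set Bset : (Σ _ : Fin (n + 1) → ℕ, Fin (n + 1) → Ideal (𝓞 K)) → Finset (Ideal (𝓞 K)) := fun b =>
    (idealsLE (Ideal.absNorm (b.2 (Fin.last n)))).filter
      (fun Q => Q.IsPrime ∧ Q ≠ ⊥ ∧ X ^ ((b.1 (Fin.last n) : ℝ) * hbXi τ) ≤ (Ideal.absNorm Q : ℝ) ∧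
        PrimeLT Q (b.2 (Fin.last n))) with hBset
  set cnt : (Σ _ : Fin (n + 1) → ℕ, Fin (n + 1) → Ideal (𝓞 K)) → Ideal (𝓞 K) → ℝ := fun b Q =>
    (#{i ∈ E | (∏ j, b.2 j) ∣ I i ∧ Q ∣ I i ∧ IsRough (X ^ ((b.1 (Fin.last n) : ℝ) * hbXi τ)) (I i)} : ℝ)
    with hcnt
  -- per tuple: split the Buchstab range
  have hsplit : ∀ b ∈ A, ∑ Q ∈ Bset b, cnt b Q ≤
      ∑ Q ∈ (Bset b).filter (fun Q => ¬ ((Ideal.absNorm Q).Prime ∧ ∀ j, Ideal.absNorm Q ≠ Ideal.absNorm (b.2 j))),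
        (famCount E I (Q * ∏ j, b.2 j) : ℝ) +
      ∑ Q ∈ (Bset b).filter (fun Q => (Ideal.absNorm Q).Prime ∧ (∀ j, Ideal.absNorm Q ≠ Ideal.absNorm (b.2 j)) ∧
          (Ideal.absNorm Q : ℝ) * Ideal.absNorm (∏ j, b.2 j) < X ^ (2 - 2 * τ)),
        (famSifted E I (Q * ∏ j, b.2 j) (X ^ τ) : ℝ) +
      ∑ Q ∈ (Bset b).filter (fun Q => (Ideal.absNorm Q).Prime ∧ (∀ j, Ideal.absNorm Q ≠ Ideal.absNorm (b.2 j)) ∧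
          X ^ (2 - 2 * τ) ≤ (Ideal.absNorm Q : ℝ) * Ideal.absNorm (∏ j, b.2 j)),
        (#{i ∈ E | (Q * ∏ j, b.2 j) ∣ I i ∧ IsRough (X ^ ((b.1 (Fin.last n) : ℝ) * hbXi τ)) (I i)} : ℝ) := by
    rintro ⟨m, P⟩ hb
    rw [hA, mem_sigma] at hb
    obtain ⟨hm, hP⟩ := hb
    have hQprops : ∀ Q ∈ Bset ⟨m, P⟩, Q.IsPrime ∧ Q ≠ ⊥ ∧ X ^ ((m (Fin.last n) : ℝ) * hbXi τ) ≤ (Ideal.absNorm Q : ℝ) ∧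
        PrimeLT Q (P (Fin.last n)) := fun Q hQ => by
      simp only [hBset, mem_filter] at hQ; exact hQ.2
    have hc := fun Q (hQ : Q ∈ Bset ⟨m, P⟩) =>
      buchstab_count_le E I hX1 hτ hτ1' hm hP (hQprops Q hQ).1 (hQprops Q hQ).2.1 (hQprops Q hQ).2.2.1 (hQprops Q hQ).2.2.2
    have hcnt0 : ∀ Q, 0 ≤ cnt ⟨m, P⟩ Q := fun Q => Nat.cast_nonneg _
    set πP : Ideal (𝓞 K) → Prop := fun Q => (Ideal.absNorm Q).Prime ∧ ∀ j, Ideal.absNorm Q ≠ Ideal.absNorm (P j)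
      with hπP
    rw [← sum_filter_add_sum_filter_not (Bset ⟨m, P⟩) πP]
    have h1 : ∑ Q ∈ (Bset ⟨m, P⟩).filter (fun Q => ¬ πP Q), cnt ⟨m, P⟩ Q ≤
        ∑ Q ∈ (Bset ⟨m, P⟩).filter (fun Q => ¬ πP Q), (famCount E I (Q * ∏ j, P j) : ℝ) :=
      sum_le_sum fun Q hQ => by
        simp only [hcnt]; exact_mod_cast (hc Q (mem_filter.mp hQ).1).2.2
    have hor : (Bset ⟨m, P⟩).filter πP =
        (Bset ⟨m, P⟩).filter (fun Q =>
          ((Ideal.absNorm Q).Prime ∧ (∀ j, Ideal.absNorm Q ≠ Ideal.absNorm (P j)) ∧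
            (Ideal.absNorm Q : ℝ) * Ideal.absNorm (∏ j, P j) < X ^ (2 - 2 * τ)) ∨
          ((Ideal.absNorm Q).Prime ∧ (∀ j, Ideal.absNorm Q ≠ Ideal.absNorm (P j)) ∧
            X ^ (2 - 2 * τ) ≤ (Ideal.absNorm Q : ℝ) * Ideal.absNorm (∏ j, P j))) := by
      refine filter_congr fun Q _ => ?_
      simp only [hπP]
      constructor
      · rintro ⟨ha, hb⟩
        rcases lt_or_ge ((Ideal.absNorm Q : ℝ) * Ideal.absNorm (∏ j, P j)) (X ^ (2 - 2 * τ)) with h' | h'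
        · exact Or.inl ⟨ha, hb, h'⟩
        · exact Or.inr ⟨ha, hb, h'⟩
      · rintro (h | h) <;> exact ⟨h.1, h.2.1⟩
    have h2 : ∑ Q ∈ (Bset ⟨m, P⟩).filter πP, cnt ⟨m, P⟩ Q ≤
        ∑ Q ∈ (Bset ⟨m, P⟩).filter (fun Q => (Ideal.absNorm Q).Prime ∧ (∀ j, Ideal.absNorm Q ≠ Ideal.absNorm (P j)) ∧
            (Ideal.absNorm Q : ℝ) * Ideal.absNorm (∏ j, P j) < X ^ (2 - 2 * τ)), cnt ⟨m, P⟩ Q +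
        ∑ Q ∈ (Bset ⟨m, P⟩).filter (fun Q => (Ideal.absNorm Q).Prime ∧ (∀ j, Ideal.absNorm Q ≠ Ideal.absNorm (P j)) ∧
            X ^ (2 - 2 * τ) ≤ (Ideal.absNorm Q : ℝ) * Ideal.absNorm (∏ j, P j)), cnt ⟨m, P⟩ Q := by
      rw [hor]
      exact sum_filter_or_le _ _ (fun Q _ => hcnt0 Q) _ _
    have h3 : ∑ Q ∈ (Bset ⟨m, P⟩).filter (fun Q => (Ideal.absNorm Q).Prime ∧ (∀ j, Ideal.absNorm Q ≠ Ideal.absNorm (P j)) ∧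
            (Ideal.absNorm Q : ℝ) * Ideal.absNorm (∏ j, P j) < X ^ (2 - 2 * τ)), cnt ⟨m, P⟩ Q ≤
        ∑ Q ∈ (Bset ⟨m, P⟩).filter (fun Q => (Ideal.absNorm Q).Prime ∧ (∀ j, Ideal.absNorm Q ≠ Ideal.absNorm (P j)) ∧
            (Ideal.absNorm Q : ℝ) * Ideal.absNorm (∏ j, P j) < X ^ (2 - 2 * τ)),
          (famSifted E I (Q * ∏ j, P j) (X ^ τ) : ℝ) :=
      sum_le_sum fun Q hQ => by
        have h := hc Q (mem_filter.mp hQ).1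
        simp only [hcnt]; rw [h.1]; exact_mod_cast h.2.1
    have h4 : ∑ Q ∈ (Bset ⟨m, P⟩).filter (fun Q => (Ideal.absNorm Q).Prime ∧ (∀ j, Ideal.absNorm Q ≠ Ideal.absNorm (P j)) ∧
            X ^ (2 - 2 * τ) ≤ (Ideal.absNorm Q : ℝ) * Ideal.absNorm (∏ j, P j)), cnt ⟨m, P⟩ Q =
        ∑ Q ∈ (Bset ⟨m, P⟩).filter (fun Q => (Ideal.absNorm Q).Prime ∧ (∀ j, Ideal.absNorm Q ≠ Ideal.absNorm (P j)) ∧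
            X ^ (2 - 2 * τ) ≤ (Ideal.absNorm Q : ℝ) * Ideal.absNorm (∏ j, P j)),
          (#{i ∈ E | (Q * ∏ j, P j) ∣ I i ∧ IsRough (X ^ ((m (Fin.last n) : ℝ) * hbXi τ)) (I i)} : ℝ) :=
      sum_congr rfl fun Q hQ => by
        have h := hc Q (mem_filter.mp hQ).1
        simp only [hcnt]; rw [h.1, famSifted]
    simp only at h1 h2 h3 h4 ⊢
    linarith
  -- sum over tuples
  have hsum := sum_le_sum hsplit
  rw [sum_add_distrib, sum_add_distrib] at hsum
  have hR1 := E3_regime1_le E I hC₁ hwin hX hτ hτ8 hXτ hC₇ hM hErr h7 (n := n)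
  have hR2c := E3_regime2_count_le E I hX1 hτ hτ1 hCN hE (n := n)
  have hR2D := E3_regime2_Dsum_le E I hC₁ hwin hX hτ hτ8 hXτ hC₇ hM hErr h7 (n := n)
  rw [sum_sigma] at hR1 hR2c
  dsimp only at hR1 hR2c
  simp only [hBset, hcnt] at hsum
  have hD0 : 0 ≤ ∑ σ' ∈ ((range (⌊X ^ (1 - τ)⌋₊ + 1)).filter
      (fun p : ℕ => p.Prime ∧ X ^ τ ≤ (p : ℝ) ∧ (p : ℝ) < X ^ (1 - τ))).powersetCard n,
      ∏ p ∈ σ', (idealNormCount K p : ℝ) * (p : ℝ)⁻¹ :=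
    sum_nonneg fun σ _ => prod_nonneg fun p _ => normWt_nonneg p
  have hLt0 : 0 ≤ ∑ p ∈ (range (⌊X ^ (1 - τ)⌋₊ + 1)).filter
      (fun p : ℕ => p.Prime ∧ X ^ τ ≤ (p : ℝ) ∧ (p : ℝ) < X ^ (1 - τ)), (idealNormCount K p : ℝ) * (p : ℝ)⁻¹ :=
    sum_nonneg fun p _ => normWt_nonneg p
  simp only [hA] at hsum
  simp only [hL]
  linarith [hsum, hR1, hR2c, hR2D]

end E3total

end Literature.NumberTheory.Sieve.CubicSieve

end
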